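import Summits.QuantumFields.YangMills.Theorems.ToronCumulantSignHaarTwist
import Summits.QuantumFields.YangMills.Theorems.ToronCumulantSignHaarMoments22
import HarnessLib

/-!
# Route `ToronCumulantSign`, crux `CommutatorSkewMoment` (stmt-QuantumFields-27530) — helper III:
# the `|tr|²`-weighted second moment and the inner conjugation integral `∫ (|tr Y|² − 1) tr(X Y X† Y†) dY`

For a compact group `G ≅ SU(N)` (`IsSpecialUnitaryModel ρ`), `N = 2 + n ≥ 2`:
* ★ the `|tr|²`-WEIGHTED SECOND MOMENT (`integral_normSqTrace_entry`):
  `∫ |tr ρ|² ρ_{jk} conj(ρ_{il}) dg = γ_N δ_{ji} δ_{kl} + C_N δ_{il} δ_{jk}`, `γ_N = (N²−2)/(N(N²−1))`, `C_N = 1/(N²−1)` — the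
  conjugation-equivariant map `A ↦ E[|tr Y|² Y A Y†] = C_N A + γ_N tr(A)·1` of the route text, obtained from the support lemmas
  (helper I) and the position-free modulus moments (helper II), no Weingarten calculus;
* hence, for EVERY matrix `X` (`integral_normSqTrace_traceConj`): `∫ |tr ρ|² tr(X ρ X† ρ†) dg = γ_N |tr X|² + C_N Σ_{ij} |X_{ij}|²`, and
  (`integral_traceConj`, degree `(1,1)`, tree `integral_entry_mul_conj_entry`) `∫ tr(X ρ X† ρ†) dg = |tr X|²/N`;
* ★★ for unitary `X` (`Σ|X_{ij}|² = N`): `∫ (|tr ρ|² − 1) tr(X ρ X† ρ†) dg = (N² − |tr X|²)/(N(N²−1))`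
  (`integral_normSqTrace_sub_one_traceConj`) — the planner's `stub_innerConjugationMoment`, for every `N ≥ 2`.
HONEST LABEL: pure compact-group integration; helper toward the OPEN crux `CommutatorSkewMoment`; nothing about the mass gap.

References: B. Collins, P. Śniady, CMP 264 (2006), Cor. 2.4; M. Creutz, *Quarks, gluons and lattices* (1983) §8.
-/

noncomputable section

open MeasureTheory Complex
open Literature.MathematicalPhysics.QuantumLattice Literature.MathematicalPhysics.QuantumFieldTheory

namespace Summit.QuantumFields.YangMills.Theorems.ToronCumulantSign

open Summit.Ventures.YMGap

section Inner

variable {n : ℕ} {G : Type*} [Group G] [TopologicalSpace G] [IsTopologicalGroup G] [CompactSpace G]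
  [MeasurableSpace G] [BorelSpace G] (ρ : G →* Matrix (Fin (2 + n)) (Fin (2 + n)) ℂ)

/-- Local shorthand: the general bidegree-(2,2) monomial `M_{r₁c₁} M_{r₂c₂} conj(M_{r₃c₃}) conj(M_{r₄c₄})`. -/
local notation3 (prettyPrint := false) "𝔪" M:max r₁:max c₁:max r₂:max c₂:max r₃:max c₃:max r₄:max c₄:max =>
  M r₁ c₁ * M r₂ c₂ * (starRingEnd ℂ) (M r₃ c₃) * (starRingEnd ℂ) (M r₄ c₄)

/-- Local shorthand: `γ_N = (N²−2)/(N(N²−1))`, `N = 2+n`. -/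
local notation3 (prettyPrint := false) "γN" => (((2 + n : ℝ) ^ 2 - 2) / ((2 + n : ℝ) * ((1 + n : ℝ) * (3 + n))) : ℝ)

/-- Local shorthand: `C_N = 1/(N²−1)`, `N = 2+n`. -/
local notation3 (prettyPrint := false) "CN" => ((1 / ((1 + n : ℝ) * (3 + n))) : ℝ)

/-- Integrability of the general monomial. [folklore] -/
theorem integrable_mono (hρ : Continuous ρ) (r₁ c₁ r₂ c₂ r₃ c₃ r₄ c₄ : Fin (2 + n)) :
    Integrable (fun g => 𝔪 (ρ g) r₁ c₁ r₂ c₂ r₃ c₃ r₄ c₄) (haarProbability G) :=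
  ((((hρ.matrix_elem r₁ c₁).mul (hρ.matrix_elem r₂ c₂)).mul (Complex.continuous_conj.comp (hρ.matrix_elem r₃ c₃))).mul
    (Complex.continuous_conj.comp (hρ.matrix_elem r₄ c₄))).integrable_of_hasCompactSupport
    (HasCompactSupport.of_compactSpace _)

omit [IsTopologicalGroup G] [CompactSpace G] [MeasurableSpace G] [BorelSpace G] in
/-- A monomial paired with itself is the (real) product of squared moduli. [folklore] -/
theorem mono_self_eq (M : Matrix (Fin (2 + n)) (Fin (2 + n)) ℂ) (r₁ c₁ r₂ c₂ : Fin (2 + n)) :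
    𝔪 M r₁ c₁ r₂ c₂ r₁ c₁ r₂ c₂ = ((Complex.normSq (M r₁ c₁) * Complex.normSq (M r₂ c₂) : ℝ) : ℂ) := by
  rw [ofReal_mul, ← Complex.mul_conj, ← Complex.mul_conj]; ring

/-- `∫ 𝔪(p, q; p, q) = ∫ |ρ_p|² |ρ_q|²` (as a real number). [folklore] -/
theorem integral_mono_self (r₁ c₁ r₂ c₂ : Fin (2 + n)) :
    ∫ g, 𝔪 (ρ g) r₁ c₁ r₂ c₂ r₁ c₁ r₂ c₂ ∂haarProbability G =
      ((∫ g, Complex.normSq (ρ g r₁ c₁) * Complex.normSq (ρ g r₂ c₂) ∂haarProbability G : ℝ) : ℂ) := by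
  simp_rw [mono_self_eq]
  exact integral_ofReal

omit [IsTopologicalGroup G] [CompactSpace G] [MeasurableSpace G] [BorelSpace G] in
/-- `|tr M|² = Σ_{m,n} M_mm conj(M_nn)`. [folklore] -/
theorem normSq_trace_eq_sum (M : Matrix (Fin (2 + n)) (Fin (2 + n)) ℂ) :
    ((Complex.normSq M.trace : ℝ) : ℂ) = ∑ m, ∑ n', M m m * (starRingEnd ℂ) (M n' n') := by
  rw [Complex.normSq_eq_conj_mul_self, Matrix.trace, mul_comm]
  simp only [Matrix.diag_apply, map_sum, Finset.sum_mul, Finset.mul_sum]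
  exact Finset.sum_comm

/-- ★ **The `|tr|²-weighted second moment**: `∫ |tr ρ|² ρ_{jk} conj(ρ_{il}) = γ_N δ_{ji}δ_{kl} + C_N δ_{il}δ_{jk}`. [folklore] -/
theorem integral_normSqTrace_entry (hρ : IsSpecialUnitaryModel ρ) (j k i l : Fin (2 + n)) :
    ∫ g, ((Complex.normSq (ρ g).trace : ℝ) : ℂ) * (ρ g j k * (starRingEnd ℂ) (ρ g i l)) ∂haarProbability G =
      (if j = i ∧ k = l then ((γN : ℝ) : ℂ) else 0) + (if i = l ∧ j = k then ((CN : ℝ) : ℂ) else 0) := by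
  -- expand `|tr|²` and exchange sum and integral
  have hexp : ∀ g : G, ((Complex.normSq (ρ g).trace : ℝ) : ℂ) * (ρ g j k * (starRingEnd ℂ) (ρ g i l)) =
      ∑ m, ∑ n', 𝔪 (ρ g) m m j k n' n' i l := by
    intro g
    rw [normSq_trace_eq_sum, Finset.sum_mul]
    refine Finset.sum_congr rfl fun m _ => ?_
    rw [Finset.sum_mul]
    refine Finset.sum_congr rfl fun n' _ => ?_
    ring
  simp_rw [hexp]
  rw [integral_finsetSum _ (fun m _ => integrable_finsetSum _ (fun n' _ => integrable_mono ρ hρ.1 m m j k n' n' i l))]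
  simp_rw [integral_finsetSum _ (fun n' _ => integrable_mono ρ hρ.1 _ _ j k n' n' i l)]
  -- the support of the summands
  by_cases hA : j = i ∧ k = l
  · obtain ⟨hji, hkl⟩ := hA
    subst hji; subst hkl
    rw [if_pos ⟨rfl, rfl⟩]
    -- only the diagonal `n' = m` survives
    have hdiag : ∀ m : Fin (2 + n), ∑ n', ∫ g, 𝔪 (ρ g) m m j k n' n' j k ∂haarProbability G =
        ((∫ g, Complex.normSq (ρ g m m) * Complex.normSq (ρ g j k) ∂haarProbability G : ℝ) : ℂ) := by
      intro m
      rw [Finset.sum_eq_single m]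
      · exact integral_mono_self ρ m m j k
      · intro n' _ hn'
        exact integral_mono_eq_zero_of_rows ρ hρ m m j k n' n' j k (by
          rintro (⟨h1, -⟩ | ⟨h1, h2⟩)
          · exact hn' h1.symm
          · exact hn' (h2 ▸ h1 ▸ rfl))
      · intro h; exact absurd (Finset.mem_univ m) h
    simp_rw [hdiag]
    rw [← ofReal_sum]
    by_cases hB : j = k
    · subst hB
      rw [if_pos ⟨rfl, rfl⟩, sum_integral_nn_diag_same ρ hρ j, ← ofReal_add]
      congr 1
      have hpos1 : (0 : ℝ) < (1 + n : ℝ) := by positivity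
      field_simp
      ring
    · rw [if_neg (fun h => hB h.1), add_zero, sum_integral_nn_diag_off ρ hρ hB]
  · rw [if_neg hA, zero_add]
    by_cases hB : i = l ∧ j = k
    · obtain ⟨hil, hjk⟩ := hB
      subst hil; subst hjk
      rw [if_pos ⟨rfl, rfl⟩]
      have hij : j ≠ i := fun h => hA ⟨h, h⟩
      -- only `(m, n') = (i, j)` survives
      rw [Finset.sum_eq_single i]
      · rw [Finset.sum_eq_single j]
        · have h := integral_mono_self ρ i i j j
          have e : ∀ g : G, 𝔪 (ρ g) i i j j i i j j = 𝔪 (ρ g) i i j j j j i i := fun g => by ring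
          simp_rw [e] at h
          rw [h, integral_nn_gen ρ hρ hij.symm hij.symm]
        · intro n' _ hn'
          exact integral_mono_eq_zero_of_rows ρ hρ i i j j n' n' i i (by
            rintro (⟨-, h2⟩ | ⟨-, h2⟩)
            · exact hij h2
            · exact hn' h2.symm)
        · intro h; exact absurd (Finset.mem_univ j) h
      · intro m _ hm
        refine Finset.sum_eq_zero fun n' _ => ?_
        exact integral_mono_eq_zero_of_rows ρ hρ m m j j n' n' i i (by
          rintro (⟨h1, h2⟩ | ⟨h1, -⟩)
          · exact hij h2
          · exact hm h1)
      · intro h; exact absurd (Finset.mem_univ i) h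
    · rw [if_neg hB]
      refine Finset.sum_eq_zero fun m _ => Finset.sum_eq_zero fun n' _ => ?_
      by_cases hr : (m = n' ∧ j = i) ∨ (m = i ∧ j = n')
      · -- rows match, so the columns do not
        refine integral_mono_eq_zero_of_cols ρ hρ m m j k n' n' i l ?_
        rintro (⟨hmn, hkl⟩ | ⟨hml, hkn⟩)
        · rcases hr with ⟨-, hji⟩ | ⟨hmi, hjn⟩
          · exact hA ⟨hji, hkl⟩
          · exact hA ⟨hjn.trans (hmn.symm.trans hmi), hkl⟩
        · rcases hr with ⟨hmn, hji⟩ | ⟨hmi, hjn⟩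
          · exact hA ⟨hji, (hkn.trans (hmn.symm.trans hml)).symm ▸ rfl⟩
          · exact hB ⟨hmi.symm.trans hml, hjn.trans hkn.symm⟩
      · exact integral_mono_eq_zero_of_rows ρ hρ m m j k n' n' i l hr

omit [IsTopologicalGroup G] [CompactSpace G] [MeasurableSpace G] [BorelSpace G] in
/-- `tr(X M X† M†) = Σ_{i,l,k,j} X_ij M_jk conj(X_lk) conj(M_il)`. [folklore] -/
theorem trace_conj_expand (X M : Matrix (Fin (2 + n)) (Fin (2 + n)) ℂ) :
    (X * M * X.conjTranspose * M.conjTranspose).trace =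
      ∑ i, ∑ l, ∑ k, ∑ j, X i j * M j k * (starRingEnd ℂ) (X l k) * (starRingEnd ℂ) (M i l) := by
  simp only [Matrix.trace, Matrix.diag_apply, Matrix.mul_apply, Matrix.conjTranspose_apply, Complex.star_def,
    Finset.sum_mul]

omit [IsTopologicalGroup G] [CompactSpace G] [MeasurableSpace G] [BorelSpace G] in
/-- `Σ_{i,l,k,j} X_ij conj(X_lk) c [j = i ∧ k = l] = c |tr X|²`. [folklore] -/
theorem sum4_delta_diag (X : Matrix (Fin (2 + n)) (Fin (2 + n)) ℂ) (c : ℂ) :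
    ∑ i, ∑ l, ∑ k, ∑ j, X i j * (starRingEnd ℂ) (X l k) * (if j = i ∧ k = l then c else 0) =
      c * ((Complex.normSq X.trace : ℝ) : ℂ) := by
  have h : ∀ i l : Fin (2 + n), ∑ k, ∑ j, X i j * (starRingEnd ℂ) (X l k) * (if j = i ∧ k = l then c else 0) =
      X i i * (starRingEnd ℂ) (X l l) * c := by
    intro i l
    rw [Finset.sum_eq_single l]
    · rw [Finset.sum_eq_single i]
      · simp
      · intro j _ hj; simp [hj]
      · intro h; exact absurd (Finset.mem_univ i) h
    · intro k _ hk; exact Finset.sum_eq_zero fun j _ => by simp [hk]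
    · intro h; exact absurd (Finset.mem_univ l) h
  simp_rw [h]
  rw [normSq_trace_eq_sum, Finset.mul_sum]
  refine Finset.sum_congr rfl fun i _ => ?_
  rw [Finset.mul_sum]
  refine Finset.sum_congr rfl fun l _ => ?_
  ring

omit [IsTopologicalGroup G] [CompactSpace G] [MeasurableSpace G] [BorelSpace G] in
/-- `Σ_{i,l,k,j} X_ij conj(X_lk) c [i = l ∧ j = k] = c Σ_{ij} |X_ij|²`. [folklore] -/
theorem sum4_delta_cross (X : Matrix (Fin (2 + n)) (Fin (2 + n)) ℂ) (c : ℂ) :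
    ∑ i, ∑ l, ∑ k, ∑ j, X i j * (starRingEnd ℂ) (X l k) * (if i = l ∧ j = k then c else 0) =
      c * ∑ i, ∑ j, ((Complex.normSq (X i j) : ℝ) : ℂ) := by
  have h : ∀ i : Fin (2 + n), ∑ l, ∑ k, ∑ j, X i j * (starRingEnd ℂ) (X l k) * (if i = l ∧ j = k then c else 0) =
      ∑ k, X i k * (starRingEnd ℂ) (X i k) * c := by
    intro i
    rw [Finset.sum_eq_single i]
    · refine Finset.sum_congr rfl fun k _ => ?_
      rw [Finset.sum_eq_single k]
      · simp
      · intro j _ hj; simp [hj]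
      · intro h; exact absurd (Finset.mem_univ k) h
    · intro l _ hl
      exact Finset.sum_eq_zero fun k _ => Finset.sum_eq_zero fun j _ => by simp [Ne.symm hl]
    · intro h; exact absurd (Finset.mem_univ i) h
  simp_rw [h]
  rw [Finset.mul_sum]
  refine Finset.sum_congr rfl fun i _ => ?_
  rw [Finset.mul_sum]
  refine Finset.sum_congr rfl fun k _ => ?_
  rw [Complex.normSq_eq_conj_mul_self]
  ring

/-- Local shorthand: the term `|tr M|² · X_ij M_jk conj(X_lk) conj(M_il)` of the expansion. -/
local notation3 (prettyPrint := false) "𝔱" X:max M:max i:max l:max k:max j:max =>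
  ((Complex.normSq (Matrix.trace M) : ℝ) : ℂ) * (X i j * M j k * (starRingEnd ℂ) (X l k) * (starRingEnd ℂ) (M i l))

omit [IsTopologicalGroup G] [CompactSpace G] [MeasurableSpace G] [BorelSpace G] in
/-- Continuity of the expansion terms. [folklore] -/
theorem continuous_term (hρ : Continuous ρ) (X : Matrix (Fin (2 + n)) (Fin (2 + n)) ℂ) (i l k j : Fin (2 + n)) :
    Continuous fun g => 𝔱 X (ρ g) i l k j := by
  refine (Complex.continuous_ofReal.comp (Complex.continuous_normSq.comp ?_)).mul ?_
  · exact (continuous_id.matrix_trace).comp hρ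
  · exact (((continuous_const.mul (hρ.matrix_elem j k)).mul continuous_const).mul
      (Complex.continuous_conj.comp (hρ.matrix_elem i l)))

/-- Integrability of finite sums of the expansion terms (continuity on a compact group). [folklore] -/
theorem integrable_of_continuous'' {f : G → ℂ} (hf : Continuous f) : Integrable f (haarProbability G) :=
  hf.integrable_of_hasCompactSupport (HasCompactSupport.of_compactSpace _)

/-- The integral of one expansion term. [folklore] -/
theorem integral_term (hρ : IsSpecialUnitaryModel ρ) (X : Matrix (Fin (2 + n)) (Fin (2 + n)) ℂ) (i l k j : Fin (2 + n)) :
    ∫ g, 𝔱 X (ρ g) i l k j ∂haarProbability G =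
      X i j * (starRingEnd ℂ) (X l k) * ((if j = i ∧ k = l then ((γN : ℝ) : ℂ) else 0) +
        (if i = l ∧ j = k then ((CN : ℝ) : ℂ) else 0)) := by
  rw [← integral_normSqTrace_entry ρ hρ j k i l, ← integral_const_mul]
  refine integral_congr_ae (ae_of_all _ fun g => ?_)
  simp only
  ring

/-- ★ **`∫ |tr ρ|² tr(X ρ X† ρ†) dg = γ_N |tr X|² + C_N Σ_{ij} |X_ij|²`** for every matrix `X`. [folklore] -/
theorem integral_normSqTrace_traceConj (hρ : IsSpecialUnitaryModel ρ) (X : Matrix (Fin (2 + n)) (Fin (2 + n)) ℂ) :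
    ∫ g, ((Complex.normSq (ρ g).trace : ℝ) : ℂ) * (X * ρ g * X.conjTranspose * (ρ g).conjTranspose).trace
        ∂haarProbability G =
      ((γN : ℝ) : ℂ) * ((Complex.normSq X.trace : ℝ) : ℂ) + ((CN : ℝ) : ℂ) * ∑ i, ∑ j, ((Complex.normSq (X i j) : ℝ) : ℂ) := by
  have hexp : ∀ g : G, ((Complex.normSq (ρ g).trace : ℝ) : ℂ) * (X * ρ g * X.conjTranspose * (ρ g).conjTranspose).trace =
      ∑ i, ∑ l, ∑ k, ∑ j, 𝔱 X (ρ g) i l k j := by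
    intro g
    rw [trace_conj_expand]
    simp only [Finset.mul_sum]
  simp_rw [hexp]
  have hc := continuous_term ρ hρ.1 X
  rw [integral_finsetSum _ (fun i _ => integrable_of_continuous'' (continuous_finsetSum _ fun l _ =>
    continuous_finsetSum _ fun k _ => continuous_finsetSum _ fun j _ => hc i l k j))]
  have h1 : ∀ i, ∫ g, ∑ l, ∑ k, ∑ j, 𝔱 X (ρ g) i l k j ∂haarProbability G =
      ∑ l, ∫ g, ∑ k, ∑ j, 𝔱 X (ρ g) i l k j ∂haarProbability G := fun i =>
    integral_finsetSum _ (fun l _ => integrable_of_continuous'' (continuous_finsetSum _ fun k _ =>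
      continuous_finsetSum _ fun j _ => hc i l k j))
  have h2 : ∀ i l, ∫ g, ∑ k, ∑ j, 𝔱 X (ρ g) i l k j ∂haarProbability G =
      ∑ k, ∫ g, ∑ j, 𝔱 X (ρ g) i l k j ∂haarProbability G := fun i l =>
    integral_finsetSum _ (fun k _ => integrable_of_continuous'' (continuous_finsetSum _ fun j _ => hc i l k j))
  have h3 : ∀ i l k, ∫ g, ∑ j, 𝔱 X (ρ g) i l k j ∂haarProbability G = ∑ j, ∫ g, 𝔱 X (ρ g) i l k j ∂haarProbability G :=
    fun i l k => integral_finsetSum _ (fun j _ => integrable_of_continuous'' (hc i l k j))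
  simp_rw [h1, h2, h3, integral_term ρ hρ X, mul_add, Finset.sum_add_distrib]
  rw [sum4_delta_diag, sum4_delta_cross]

/-- Local shorthand: the degree-(1,1) term `X_ij M_jk conj(X_lk) conj(M_il)`. -/
local notation3 (prettyPrint := false) "𝔰" X:max M:max i:max l:max k:max j:max =>
  X i j * M j k * (starRingEnd ℂ) (X l k) * (starRingEnd ℂ) (M i l)

omit [IsTopologicalGroup G] [CompactSpace G] [MeasurableSpace G] [BorelSpace G] in
/-- Continuity of the degree-(1,1) terms. [folklore] -/
theorem continuous_term₁ (hρ : Continuous ρ) (X : Matrix (Fin (2 + n)) (Fin (2 + n)) ℂ) (i l k j : Fin (2 + n)) :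
    Continuous fun g => 𝔰 X (ρ g) i l k j :=
  (((continuous_const.mul (hρ.matrix_elem j k)).mul continuous_const).mul
    (Complex.continuous_conj.comp (hρ.matrix_elem i l)))

/-- The integral of one degree-(1,1) term (tree `integral_entry_mul_conj_entry`). [folklore] -/
theorem integral_term₁ (hρ : IsSpecialUnitaryModel ρ) (X : Matrix (Fin (2 + n)) (Fin (2 + n)) ℂ) (i l k j : Fin (2 + n)) :
    ∫ g, 𝔰 X (ρ g) i l k j ∂haarProbability G =
      X i j * (starRingEnd ℂ) (X l k) * (if j = i ∧ k = l then ((2 + n : ℕ) : ℂ)⁻¹ else 0) := by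
  rw [← RobustBall.HaarSecondMoments.integral_entry_mul_conj_entry ρ hρ j k i l, ← integral_const_mul]
  refine integral_congr_ae (ae_of_all _ fun g => ?_)
  simp only
  ring

/-- **`∫ tr(X ρ X† ρ†) dg = |tr X|²/N`** for every matrix `X` (Schur orthogonality of the fundamental representation). [folklore] -/
theorem integral_traceConj (hρ : IsSpecialUnitaryModel ρ) (X : Matrix (Fin (2 + n)) (Fin (2 + n)) ℂ) :
    ∫ g, (X * ρ g * X.conjTranspose * (ρ g).conjTranspose).trace ∂haarProbability G =
      ((2 + n : ℕ) : ℂ)⁻¹ * ((Complex.normSq X.trace : ℝ) : ℂ) := by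
  simp_rw [trace_conj_expand]
  have hc := continuous_term₁ ρ hρ.1 X
  rw [integral_finsetSum _ (fun i _ => integrable_of_continuous'' (continuous_finsetSum _ fun l _ =>
    continuous_finsetSum _ fun k _ => continuous_finsetSum _ fun j _ => hc i l k j))]
  have h1 : ∀ i, ∫ g, ∑ l, ∑ k, ∑ j, 𝔰 X (ρ g) i l k j ∂haarProbability G =
      ∑ l, ∫ g, ∑ k, ∑ j, 𝔰 X (ρ g) i l k j ∂haarProbability G := fun i =>
    integral_finsetSum _ (fun l _ => integrable_of_continuous'' (continuous_finsetSum _ fun k _ =>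
      continuous_finsetSum _ fun j _ => hc i l k j))
  have h2 : ∀ i l, ∫ g, ∑ k, ∑ j, 𝔰 X (ρ g) i l k j ∂haarProbability G =
      ∑ k, ∫ g, ∑ j, 𝔰 X (ρ g) i l k j ∂haarProbability G := fun i l =>
    integral_finsetSum _ (fun k _ => integrable_of_continuous'' (continuous_finsetSum _ fun j _ => hc i l k j))
  have h3 : ∀ i l k, ∫ g, ∑ j, 𝔰 X (ρ g) i l k j ∂haarProbability G = ∑ j, ∫ g, 𝔰 X (ρ g) i l k j ∂haarProbability G :=
    fun i l k => integral_finsetSum _ (fun j _ => integrable_of_continuous'' (hc i l k j))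
  simp_rw [h1, h2, h3, integral_term₁ ρ hρ X]
  rw [sum4_delta_diag]

omit [IsTopologicalGroup G] [CompactSpace G] [MeasurableSpace G] [BorelSpace G] in
/-- For a unitary matrix `Σ_{ij} |X_ij|² = N`. [folklore] -/
theorem sum_normSq_entries_of_mem_unitaryGroup {X : Matrix (Fin (2 + n)) (Fin (2 + n)) ℂ}
    (hX : X ∈ Matrix.unitaryGroup (Fin (2 + n)) ℂ) :
    ∑ i, ∑ j, ((Complex.normSq (X i j) : ℝ) : ℂ) = ((2 + n : ℕ) : ℂ) := by
  rw [Matrix.mem_unitaryGroup_iff] at hX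
  have hrow : ∀ i : Fin (2 + n), ∑ j, ((Complex.normSq (X i j) : ℝ) : ℂ) = 1 := by
    intro i
    have h := congrFun (congrFun hX i) i
    rw [Matrix.mul_apply, Matrix.one_apply_eq] at h
    rw [← h]
    refine Finset.sum_congr rfl fun j _ => ?_
    rw [Matrix.star_apply, Complex.star_def, Complex.mul_conj]
  simp_rw [hrow]
  simp

omit [IsTopologicalGroup G] [CompactSpace G] [MeasurableSpace G] [BorelSpace G] in
/-- Continuity of `g ↦ tr(X ρ(g) X† ρ(g)†)`. [folklore] -/
theorem continuous_traceConj (hρ : Continuous ρ) (X : Matrix (Fin (2 + n)) (Fin (2 + n)) ℂ) :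
    Continuous fun g => (X * ρ g * X.conjTranspose * (ρ g).conjTranspose).trace := by
  refine continuous_id.matrix_trace.comp ?_
  exact ((continuous_const.mul hρ).mul continuous_const).mul (continuous_id.matrix_conjTranspose.comp hρ)

/-- ★★ **The inner conjugation moment** (the planner's `stub_innerConjugationMoment`, every `N ≥ 2`): for unitary `X`,
`∫ (|tr ρ|² − 1) tr(X ρ X† ρ†) dg = (N² − |tr X|²)/(N(N² − 1))`. [folklore] -/
theorem integral_normSqTrace_sub_one_traceConj (hρ : IsSpecialUnitaryModel ρ) {X : Matrix (Fin (2 + n)) (Fin (2 + n)) ℂ}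
    (hX : X ∈ Matrix.unitaryGroup (Fin (2 + n)) ℂ) :
    ∫ g, (((Complex.normSq (ρ g).trace : ℝ) : ℂ) - 1) * (X * ρ g * X.conjTranspose * (ρ g).conjTranspose).trace
        ∂haarProbability G =
      ((((2 + n : ℝ) ^ 2 - Complex.normSq X.trace) / ((2 + n : ℝ) * ((1 + n : ℝ) * (3 + n))) : ℝ) : ℂ) := by
  have hcw : Continuous fun g => ((Complex.normSq (ρ g).trace : ℝ) : ℂ) *
      (X * ρ g * X.conjTranspose * (ρ g).conjTranspose).trace :=
    (Complex.continuous_ofReal.comp (Complex.continuous_normSq.comp ((continuous_id.matrix_trace).comp hρ.1))).mul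
      (continuous_traceConj ρ hρ.1 X)
  simp_rw [sub_mul, one_mul]
  rw [integral_sub (integrable_of_continuous'' hcw) (integrable_of_continuous'' (continuous_traceConj ρ hρ.1 X)),
    integral_normSqTrace_traceConj ρ hρ X, integral_traceConj ρ hρ X, sum_normSq_entries_of_mem_unitaryGroup hX]
  have hpos1 : (0 : ℝ) < (1 + n : ℝ) := by positivity
  have hpos2 : (0 : ℝ) < (2 + n : ℝ) := by positivity
  have hpos3 : (0 : ℝ) < (3 + n : ℝ) := by positivity
  have hreal : (((2 + n : ℝ) ^ 2 - 2) / ((2 + n : ℝ) * ((1 + n : ℝ) * (3 + n)))) * Complex.normSq X.trace +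
      (1 / ((1 + n : ℝ) * (3 + n))) * (2 + n : ℝ) - (2 + n : ℝ)⁻¹ * Complex.normSq X.trace =
      ((2 + n : ℝ) ^ 2 - Complex.normSq X.trace) / ((2 + n : ℝ) * ((1 + n : ℝ) * (3 + n))) := by
    field_simp
    ring
  have hcast := congrArg (fun x : ℝ => (x : ℂ)) hreal
  push_cast at hcast ⊢
  exact hcast

end Inner

end Summit.QuantumFields.YangMills.Theorems.ToronCumulantSign
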